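import Literature.NumberTheory.Transcendental.KZIntervalPeriodProofs
import Summits.KontsevichZagierPeriods.KontsevichZagierPeriods.Theorems.ValuedFieldSpecialisationDefs
import Summits.KontsevichZagierPeriods.KontsevichZagierPeriods.Theorems.ValuedFieldSpecialisationClassLevelExpansionFibreDimOneToolkit

/-!
# Route ValuedFieldSpecialisation — dominated families with zero limit

Helper for item stmt-KontsevichZagierPeriods-3503 (`ClassLevelExpansionFibreDimOne`). The
class-level expansion produces remainders that are families `S` (read over `s = z 0`) whose
integrand is bounded on `0 < s < ε` by a constant on a set of finite measure and tends to `0` as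
`s → 0⁺` along almost every fibre. Such a family is DOMINATED (`KZ.IsDominatedFamily`) with the zero
representation as special fibre, hence its class is expandable:

* `exists_zeroRep`, `exists_constRepOn` — the zero representation on a `ℚ`-semialgebraic set and
  the constant representation on a `ℚ`-semialgebraic set of finite measure (any dimension);
* `of_mem_expandable_of_dominated_zero` — constant envelope, limit `0`, eventual domain `D₀`;
* `of_mem_expandable_of_dominated_zero_of_bound` — the same with the limit clause discharged by a
  bound `|S.integrand (s, x)| ≤ B s` with `B s → 0`.

Source: M. Kontsevich, D. Zagier (2001), §1.2; folklore (Lebesgue dominated convergence set-up).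
Deliberately NOT here: any particular remainder.
-/

noncomputable section

namespace Summit.KontsevichZagierPeriods.ValuedFieldSpecialisation

open MeasureTheory Set Filter
open scoped Topology
open Literature.NumberTheory.Transcendental Literature.NumberTheory.Transcendental.KZ
open Literature.ModelTheory.ExponentialFields (IsSemialgebraic)

variable {d : ℕ}

/-- The zero representation on a `ℚ`-semialgebraic set. [folklore] -/
theorem exists_zeroRep {D : Set (Fin d → ℝ)} (hD : IsSemialgebraic ℚ D) :
    ∃ r : IntegralRep d, r.domain = D ∧ r.integrand = fun _ => 0 := by
  refine ⟨⟨D, fun _ => 0, hD, ?_, integrableOn_zero⟩, rfl, rfl⟩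
  simpa using isSemialgebraicFunOn_ratCast hD 0

/-- The constant representation `C` on a `ℚ`-semialgebraic set of finite measure. [folklore] -/
theorem exists_constRepOn {D : Set (Fin d → ℝ)} (hD : IsSemialgebraic ℚ D) (hvol : volume D ≠ ⊤)
    (C : ℚ) : ∃ g : IntegralRep d, g.domain = D ∧ g.integrand = fun _ => (C : ℝ) :=
  ⟨⟨D, fun _ => (C : ℝ), hD, isSemialgebraicFunOn_ratCast hD C, integrableOn_const hvol⟩,
    rfl, rfl⟩

/-- **A family bounded by a constant on a set of finite measure and tending to zero fibrewise is
expandable** (it is dominated, with the zero representation on `D₀` as special fibre): `S` read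
over `s = z 0`; for `0 < s < ε` the fibre points lie in `D` (finite measure) and
`|S.integrand| ≤ C`; for a.e. `x`, eventually `(s, x) ∈ S.domain ↔ x ∈ D₀`, and for a.e. `x ∈ D₀`,
`S.integrand (s, x) → 0`. [Kontsevich–Zagier 2001, §1.2] [folklore] -/
theorem of_mem_expandable_of_dominated_zero (S : IntegralRep (d + 1)) {ε : ℝ} (hε : 0 < ε)
    {D D₀ : Set (Fin d → ℝ)} (hD : IsSemialgebraic ℚ D) (hvol : volume D ≠ ⊤)
    (hD₀ : IsSemialgebraic ℚ D₀) (C : ℚ)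
    (hfib : ∀ z ∈ S.domain, 0 < z 0 → z 0 < ε →
      (fun i : Fin d => z i.succ) ∈ D ∧ |S.integrand z| ≤ C)
    (hev : ∀ᵐ x : Fin d → ℝ, ∀ᶠ s in 𝓝[>] (0 : ℝ), (Matrix.vecCons s x ∈ S.domain ↔ x ∈ D₀))
    (hlim : ∀ᵐ x : Fin d → ℝ, x ∈ D₀ →
      Tendsto (fun s : ℝ => S.integrand (Matrix.vecCons s x)) (𝓝[>] 0) (𝓝 0)) :
    of S ∈ expandable := by
  obtain ⟨r₀, hr₀d, hr₀i⟩ := exists_zeroRep hD₀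
  obtain ⟨g, hgd, hgi⟩ := exists_constRepOn hD hvol C
  refine of_mem_expandable_of_isDominatedFamily (S := S) (r₀ := r₀) (g := g) ⟨⟨ε, hε, ?_⟩, ?_, ?_⟩
  · intro z hz h0 hzε
    rw [hgd, hgi]
    exact hfib z hz h0 hzε
  · simpa only [hr₀d] using hev
  · simpa only [hr₀d, hr₀i] using hlim

/-- The same, with the limit clause discharged by a bound: `|S.integrand z| ≤ B (z 0)` on the
fibres over `0 < s < ε`, `B ≤ C` there and `B s → 0` as `s → 0⁺`.
[Kontsevich–Zagier 2001, §1.2] [folklore] -/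
theorem of_mem_expandable_of_dominated_zero_of_bound (S : IntegralRep (d + 1)) {ε : ℝ} (hε : 0 < ε)
    {D D₀ : Set (Fin d → ℝ)} (hD : IsSemialgebraic ℚ D) (hvol : volume D ≠ ⊤)
    (hD₀ : IsSemialgebraic ℚ D₀) {C : ℚ} {B : ℝ → ℝ}
    (hfib : ∀ z ∈ S.domain, 0 < z 0 → z 0 < ε →
      (fun i : Fin d => z i.succ) ∈ D ∧ |S.integrand z| ≤ B (z 0))
    (hBC : ∀ s, 0 < s → s < ε → B s ≤ C) (hB0 : Tendsto B (𝓝[>] 0) (𝓝 0))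
    (hev : ∀ᵐ x : Fin d → ℝ, ∀ᶠ s in 𝓝[>] (0 : ℝ), (Matrix.vecCons s x ∈ S.domain ↔ x ∈ D₀)) :
    of S ∈ expandable := by
  refine of_mem_expandable_of_dominated_zero S hε hD hvol hD₀ C
    (fun z hz h0 hzε => ⟨(hfib z hz h0 hzε).1, (hfib z hz h0 hzε).2.trans (hBC _ h0 hzε)⟩) hev ?_
  filter_upwards [hev] with x hx hxD₀
  have hmem : ∀ᶠ s in 𝓝[>] (0 : ℝ), Matrix.vecCons s x ∈ S.domain := hx.mono fun s hs => hs.mpr hxD₀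
  have hpos : ∀ᶠ s in 𝓝[>] (0 : ℝ), 0 < s ∧ s < ε := Ioo_mem_nhdsGT hε
  refine squeeze_zero_norm' ?_ hB0
  filter_upwards [hmem, hpos] with s hs hs'
  have := (hfib _ hs (by simpa using hs'.1) (by simpa using hs'.2)).2
  simpa [Real.norm_eq_abs] using this

/-- Variant with a non-constant envelope: `|S.integrand (s, x)| ≤ B s · g.integrand x` on the
fibres over `0 < s < ε` (fibre points in `g.domain`), `0 ≤ g.integrand` there, `B ≤ 1` and
`B s → 0`. [Kontsevich–Zagier 2001, §1.2] [folklore] -/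
theorem of_mem_expandable_of_dominated_zero_envelope (S : IntegralRep (d + 1)) {ε : ℝ} (hε : 0 < ε)
    (g : IntegralRep d) {D₀ : Set (Fin d → ℝ)} (hD₀ : IsSemialgebraic ℚ D₀) {B : ℝ → ℝ}
    (hfib : ∀ z ∈ S.domain, 0 < z 0 → z 0 < ε →
      (fun i : Fin d => z i.succ) ∈ g.domain ∧ 0 ≤ g.integrand (fun i : Fin d => z i.succ) ∧
        |S.integrand z| ≤ B (z 0) * g.integrand (fun i : Fin d => z i.succ))
    (hB1 : ∀ s, 0 < s → s < ε → B s ≤ 1) (hB0 : Tendsto B (𝓝[>] 0) (𝓝 0))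
    (hev : ∀ᵐ x : Fin d → ℝ, ∀ᶠ s in 𝓝[>] (0 : ℝ), (Matrix.vecCons s x ∈ S.domain ↔ x ∈ D₀)) :
    of S ∈ expandable := by
  obtain ⟨r₀, hr₀d, hr₀i⟩ := exists_zeroRep hD₀
  refine of_mem_expandable_of_isDominatedFamily (S := S) (r₀ := r₀) (g := g) ⟨⟨ε, hε, ?_⟩, ?_, ?_⟩
  · intro z hz h0 hzε
    obtain ⟨hmem, hg0, hle⟩ := hfib z hz h0 hzε
    exact ⟨hmem, hle.trans (by nlinarith [hB1 _ h0 hzε])⟩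
  · simpa only [hr₀d] using hev
  · rw [hr₀d, hr₀i]
    filter_upwards [hev] with x hx hxD₀
    have hmem : ∀ᶠ s in 𝓝[>] (0 : ℝ), Matrix.vecCons s x ∈ S.domain :=
      hx.mono fun s hs => hs.mpr hxD₀
    have hpos : ∀ᶠ s in 𝓝[>] (0 : ℝ), 0 < s ∧ s < ε := Ioo_mem_nhdsGT hε
    have hB0' : Tendsto (fun s => B s * g.integrand x) (𝓝[>] 0) (𝓝 0) := by
      simpa using hB0.mul_const (g.integrand x)
    refine squeeze_zero_norm' ?_ hB0'
    filter_upwards [hmem, hpos] with s hs hs'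
    have := (hfib _ hs (by simpa using hs'.1) (by simpa using hs'.2)).2.2
    simpa [Real.norm_eq_abs] using this

end Summit.KontsevichZagierPeriods.ValuedFieldSpecialisation
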